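import Mathlib
import Literature.NumberTheory.Transcendental.KZSemiCanonicalReductionDimOne
import Summits.KontsevichZagierPeriods.KontsevichZagierPeriods.Theorems.InverseLandauTateLiftingDimOneUnitChart

/-!
# `TateLifting` (stmt-KontsevichZagierPeriods-9129), line `Sketch` — stub `stub_cylinderBase`

THE CYLINDER BASE READING. The all-dimensional cylinder sector of the line works with cube
representations `[(0,1)ⁿ⁺¹, P(z)/q(z₀)]` whose integrand is written over the field
`K = ℚ̄ ∩ ℝ = algebraicClosure ℚ ℝ` of real algebraic numbers: `P : MvPolynomial (Fin (n+1)) K`,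
`q : K[x]`. After `n` cubical Stokes moves one is left with `n = 0`, i.e. `P ∈ K[z₀]` as an
`MvPolynomial (Fin 1) K` and `q ∈ K[x]`, whereas the landed dimension-one sector
(`kzKernelConjecture_lowDimAlg`, `Theorems/InverseLandauTateLiftingLowDimAlgSector.lean`) speaks of
REAL univariate polynomials with real-algebraic coefficients evaluated at `z 0`. This file is the
dictionary between the two languages:

* `p := (MvPolynomial.aeval (fun _ => X) P).map (algebraMap K ℝ)` — substitute the polynomial
  variable `X ∈ K[X]` for the single variable `z₀` and push the coefficients into `ℝ`;
* `q' := q.map (algebraMap K ℝ)`.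

Both have real-algebraic coefficients (`DimOne.uc_isAlgebraic_coeff`: a coefficient of `f.map
(algebraMap K ℝ)` is the image of an element of `K`), and for every `z : Fin 1 → ℝ`
`MvPolynomial.aeval z P = p.eval (z 0)` (`z = fun _ => z 0` in dimension one,
`KZ.eq_const_apply_zero`, and `MvPolynomial.comp_aeval`), `Polynomial.aeval (z 0) q = q'.eval (z 0)`
(`Polynomial.aeval_def`, `Polynomial.eval_map`).

References: M. Kontsevich, D. Zagier, *Periods* (2001), §1.1 (the ring of periods; "rational" may be
replaced by "algebraic").
-/

noncomputable section

open Polynomial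
open Literature.NumberTheory.Transcendental

namespace Summit.KontsevichZagierPeriods.InverseLandau

namespace Cylinder

/-- Univariate reading over `K = ℚ̄ ∩ ℝ` of a polynomial in the single variable `z₀`: evaluating
`P ∈ K[z₀]` at a real point `z ∈ ℝ¹` is evaluating at `z 0` the real polynomial attached to the
substitution `z₀ ↦ X` of `P`. [folklore] -/
theorem cb_aeval_eq_eval_map (P : MvPolynomial (Fin 1) (algebraicClosure ℚ ℝ)) (z : Fin 1 → ℝ) :
    (MvPolynomial.aeval z P : ℝ) =
      ((MvPolynomial.aeval (fun _ : Fin 1 => (X : (algebraicClosure ℚ ℝ)[X])) P).map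
        (algebraMap (algebraicClosure ℚ ℝ) ℝ)).eval (z 0) := by
  rw [Polynomial.eval_map, ← Polynomial.aeval_def, ← AlgHom.comp_apply, MvPolynomial.comp_aeval]
  conv_lhs => rw [KZ.eq_const_apply_zero z]
  simp

/-- Evaluating `q ∈ K[x]` at a real point through `K → ℝ` is evaluating the real polynomial attached
to `q`. [folklore] -/
theorem cb_aeval_eq_eval_map_univ (q : (algebraicClosure ℚ ℝ)[X]) (t : ℝ) :
    (Polynomial.aeval t q : ℝ) = (q.map (algebraMap (algebraicClosure ℚ ℝ) ℝ)).eval t := by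
  rw [Polynomial.eval_map, Polynomial.aeval_def]

end Cylinder

/-- **The cylinder base reading.** In dimension one, `P ∈ K[z₀]` (as an `MvPolynomial (Fin 1) K`,
`K = ℚ̄ ∩ ℝ`) and `q ∈ K[x]` read as real one-variable polynomials `p, q'` with real-algebraic
coefficients: `p = (MvPolynomial.aeval (fun _ => X) P).map (algebraMap K ℝ)`,
`q' = q.map (algebraMap K ℝ)`, with `P(z) = p(z 0)` and `q(z 0) = q'(z 0)` for every `z ∈ ℝ¹` — the
interface of the landed dimension-one algebraic-coefficient sector. [folklore] -/
theorem tateLifting_cylinderBase :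
    ∀ (P : MvPolynomial (Fin 1) (algebraicClosure ℚ ℝ)) (q : Polynomial (algebraicClosure ℚ ℝ)),
      ∃ (p q' : Polynomial ℝ), (∀ i, IsAlgebraic ℚ (p.coeff i)) ∧ (∀ i, IsAlgebraic ℚ (q'.coeff i)) ∧
        ∀ z : Fin 1 → ℝ, (MvPolynomial.aeval z P : ℝ) = p.eval (z 0) ∧
          (Polynomial.aeval (z 0) q : ℝ) = q'.eval (z 0) := by
  intro P q
  exact ⟨_, _, DimOne.uc_isAlgebraic_coeff _, DimOne.uc_isAlgebraic_coeff q, fun z =>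
    ⟨Cylinder.cb_aeval_eq_eval_map P z, Cylinder.cb_aeval_eq_eval_map_univ q (z 0)⟩⟩

end Summit.KontsevichZagierPeriods.InverseLandau

end
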